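import Literature.NumberTheory.GaloisRepresentations.ArtinDirichletCoefficients

/-!
# SoloInformedEulerProductSummability — `∑ |γ(n)| n^δ < ∞` from prime-power bounds with vanishing prime values

Solo unit `solo-Parity-informed` (ideation tier, informed mode), session 17; `PLAN.md` §25.3 (α1), CLAIMS C84.

Let `γ` be a real multiplicative arithmetic function and `t_p ∈ [0, 1 - 1/p]` numbers with
`|γ(p^k)| ≤ (2k+1) t_p^k` (`k ≥ 1`) for every prime `p`, and suppose that for the primes `p > Q`
one has `γ(p) = 0` and `t_p ≤ D/p`.  Then `∑_n |γ(n)| n^δ < ∞` for some `δ > 0`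
(`summable_abs_mul_rpow_of_prime_pow_bound`).

Proof: with `δ = 1/(4(Q'+1)²)`, `Q' = max(Q, 4⌈D⌉²)`, every local ratio `u_p = t_p p^δ` is `< 1`
(Bernoulli's inequality for `p ≤ Q'`, `u_p ≤ D p^{-3/4} ≤ 1/2` for `p > Q'`), the local factors
`∑_k |γ(p^k)| p^{kδ}` are finite, and for `p > Q'` they are `≤ 1 + 14 D² p^{-3/2}` because the
`k = 1` term vanishes; the absolutely convergent Euler product criterion
`Literature.NumberTheory.GaloisRepresentations.summable_norm_of_summable_norm_prime_pow` concludes.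
This is the summability half of the convolution structure `μρ_{Gg} = μρ_G ⋆ μρ_g ⋆ γ` of the
root-count functions of coprime integer polynomials (`SoloInformedMoebiusRootCountInverse`).
-/

namespace Summit.Parity.BatemanHorn.Theorems

open Finset Real ArithmeticFunction
open Literature.NumberTheory.GaloisRepresentations

/-! ### Two series estimates -/

/-- `∑_k (2k+1) u^k` converges for `0 ≤ u < 1`. -/
theorem summable_two_mul_add_one_mul_pow {u : ℝ} (hu0 : 0 ≤ u) (hu1 : u < 1) :
    Summable fun k : ℕ => (2 * (k : ℝ) + 1) * u ^ k := by
  have hn : ‖u‖ < 1 := by rw [Real.norm_eq_abs, abs_of_nonneg hu0]; exact hu1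
  have h1 : Summable fun k : ℕ => ((k : ℝ) ^ 1 : ℝ) * u ^ k :=
    summable_pow_mul_geometric_of_norm_lt_one 1 hn
  have h2 : Summable fun k : ℕ => u ^ k := summable_geometric_of_lt_one hu0 hu1
  refine ((h1.mul_left 2).add h2).congr fun k => ?_
  ring

/-- `∑_j (2j+5) u^j ≤ 14` for `0 ≤ u ≤ 1/2`. -/
theorem tsum_two_mul_add_five_mul_pow_le {u : ℝ} (hu0 : 0 ≤ u) (hu : u ≤ 1 / 2) :
    ∑' j : ℕ, (2 * (j : ℝ) + 5) * u ^ j ≤ 14 := by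
  have hr : ‖(1 / 2 : ℝ)‖ < 1 := by rw [Real.norm_eq_abs, abs_of_nonneg (by norm_num)]; norm_num
  have hA : HasSum (fun j : ℕ => (j : ℝ) * (1 / 2 : ℝ) ^ j) 2 := by
    have := hasSum_coe_mul_geometric_of_norm_lt_one hr
    norm_num at this
    exact this
  have hB : HasSum (fun j : ℕ => (1 / 2 : ℝ) ^ j) 2 := by
    have := hasSum_geometric_of_lt_one (by norm_num : (0 : ℝ) ≤ 1 / 2) (by norm_num : (1 / 2 : ℝ) < 1)
    norm_num at this
    exact this
  have hC : HasSum (fun j : ℕ => (2 * (j : ℝ) + 5) * (1 / 2 : ℝ) ^ j) 14 := by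
    have h14 : (14 : ℝ) = 2 * 2 + 5 * 2 := by norm_num
    have heq : (fun j : ℕ => (2 * (j : ℝ) + 5) * (1 / 2 : ℝ) ^ j) =
        fun j : ℕ => 2 * ((j : ℝ) * (1 / 2 : ℝ) ^ j) + 5 * (1 / 2 : ℝ) ^ j := by
      funext j; ring
    rw [heq, h14]
    exact (hA.mul_left 2).add (hB.mul_left 5)
  have hu1 : u < 1 := by linarith
  calc ∑' j : ℕ, (2 * (j : ℝ) + 5) * u ^ j ≤ ∑' j : ℕ, (2 * (j : ℝ) + 5) * (1 / 2 : ℝ) ^ j := by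
        refine Summable.tsum_le_tsum (fun j => ?_) ?_ hC.summable
        · exact mul_le_mul_of_nonneg_left (pow_le_pow_left₀ hu0 hu j) (by positivity)
        · have h1 := summable_two_mul_add_one_mul_pow hu0 hu1
          have h2 : Summable fun k : ℕ => u ^ k := summable_geometric_of_lt_one hu0 hu1
          refine (h1.add (h2.mul_left 4)).congr fun k => ?_
          ring
    _ = 14 := hC.tsum_eq

/-! ### The summability criterion -/

/-- **Absolute summability with room from prime-power bounds.**  See the module docstring. -/
theorem summable_abs_mul_rpow_of_prime_pow_bound {γ : ArithmeticFunction ℝ}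
    (hγ : γ.IsMultiplicative) {t : ℕ → ℝ} {D : ℝ} {Q : ℕ}
    (ht0 : ∀ p : ℕ, p.Prime → 0 ≤ t p) (ht1 : ∀ p : ℕ, p.Prime → t p ≤ 1 - 1 / p)
    (hbound : ∀ p k : ℕ, p.Prime → 1 ≤ k → |γ (p ^ k)| ≤ (2 * k + 1) * t p ^ k)
    (hgood : ∀ p : ℕ, p.Prime → Q < p → γ p = 0 ∧ t p ≤ D / p) :
    ∃ δ : ℝ, 0 < δ ∧ Summable fun n => |γ n| * (n : ℝ) ^ δ := by
  -- parameters
  set D' : ℝ := max D 1 with hD'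
  have hD'1 : 1 ≤ D' := le_max_right _ _
  have hDD' : D ≤ D' := le_max_left _ _
  set Q' : ℕ := max Q (4 * ⌈D'⌉₊ ^ 2) with hQ'
  have hQQ' : Q ≤ Q' := le_max_left _ _
  set δ : ℝ := 1 / (4 * ((Q' : ℝ) + 1) ^ 2) with hδ
  have hδ0 : 0 < δ := by positivity
  have hδ4 : δ ≤ 1 / 4 := by
    rw [hδ]
    refine one_div_le_one_div_of_le (by norm_num) ?_
    nlinarith [sq_nonneg (Q' : ℝ), (Nat.cast_nonneg Q' : (0 : ℝ) ≤ Q')]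
  have hδ1 : δ ≤ 1 := by linarith
  -- the local ratios `u_p = t_p p^δ`
  set u : ℕ → ℝ := fun p => t p * (p : ℝ) ^ δ with hu
  have hu0 : ∀ p : ℕ, p.Prime → 0 ≤ u p := fun p hp => mul_nonneg (ht0 p hp) (by positivity)
  -- small primes: Bernoulli
  have hu_small : ∀ p : ℕ, p.Prime → p ≤ Q' → u p < 1 := by
    intro p hp hpQ
    have hp1 : (1 : ℝ) ≤ p := by exact_mod_cast hp.one_lt.le
    have hp0 : (0 : ℝ) < p := by linarith
    have hbern : (p : ℝ) ^ δ ≤ 1 + δ * ((p : ℝ) - 1) := by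
      have := rpow_one_add_le_one_add_mul_self (s := (p : ℝ) - 1) (by linarith) hδ0.le hδ1
      rwa [show (1 : ℝ) + ((p : ℝ) - 1) = p by ring] at this
    have hsmall : δ * ((p : ℝ) - 1) ^ 2 < 1 := by
      have hpQ' : (p : ℝ) - 1 ≤ Q' := by
        have : (p : ℝ) ≤ Q' := by exact_mod_cast hpQ
        linarith
      have h1 : ((p : ℝ) - 1) ^ 2 ≤ (Q' : ℝ) ^ 2 := pow_le_pow_left₀ (by linarith) hpQ' 2
      rw [hδ]
      calc 1 / (4 * ((Q' : ℝ) + 1) ^ 2) * ((p : ℝ) - 1) ^ 2 ≤ 1 / (4 * ((Q' : ℝ) + 1) ^ 2) * (Q' : ℝ) ^ 2 :=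
            mul_le_mul_of_nonneg_left h1 (by positivity)
        _ < 1 := by
            rw [div_mul_eq_mul_div, one_mul, div_lt_one (by positivity)]
            nlinarith [(Nat.cast_nonneg Q' : (0 : ℝ) ≤ Q')]
    calc u p = t p * (p : ℝ) ^ δ := rfl
      _ ≤ (1 - 1 / p) * (1 + δ * ((p : ℝ) - 1)) :=
          mul_le_mul (ht1 p hp) hbern (by positivity) (by
            rw [sub_nonneg, div_le_one hp0]; exact hp1)
      _ = (((p : ℝ) - 1) * (1 + δ * ((p : ℝ) - 1))) / p := by field_simp
      _ < (p : ℝ) / p := by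
          refine div_lt_div_of_pos_right ?_ hp0
          nlinarith
      _ = 1 := div_self hp0.ne'
  -- large primes: `u_p ≤ D' p^{-3/4} ≤ 1/2`
  have hu_large : ∀ p : ℕ, p.Prime → Q' < p →
      γ p = 0 ∧ u p ≤ D' * (p : ℝ) ^ (-(3 / 4 : ℝ)) ∧ u p ≤ 1 / 2 := by
    intro p hp hpQ
    have hp0 : (0 : ℝ) < p := by exact_mod_cast hp.pos
    obtain ⟨hγp, htp⟩ := hgood p hp (lt_of_le_of_lt hQQ' hpQ)
    have h1 : u p ≤ D' * (p : ℝ) ^ (-(3 / 4 : ℝ)) := by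
      calc u p = t p * (p : ℝ) ^ δ := rfl
        _ ≤ D' / p * (p : ℝ) ^ (1 / 4 : ℝ) := by
            refine mul_le_mul (htp.trans (div_le_div_of_nonneg_right hDD' hp0.le))
              (Real.rpow_le_rpow_of_exponent_le (by exact_mod_cast hp.one_lt.le) hδ4)
              (by positivity) (by positivity)
        _ = D' * (p : ℝ) ^ (-(3 / 4 : ℝ)) := by
            rw [div_eq_mul_inv, ← Real.rpow_neg_one, mul_assoc, ← Real.rpow_add hp0]
            norm_num
    -- `p > 4 ⌈D'⌉² ≥ 4 D'²`, so `p^{3/4} ≥ p^{1/2} ≥ 2 D'`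
    have hp4 : 4 * D' ^ 2 ≤ (p : ℝ) := by
      have h' : 4 * ⌈D'⌉₊ ^ 2 < p := lt_of_le_of_lt (le_max_right _ _) hpQ
      have h'' : (4 : ℝ) * (⌈D'⌉₊ : ℝ) ^ 2 ≤ p := by exact_mod_cast h'.le
      have hceil : D' ≤ (⌈D'⌉₊ : ℝ) := Nat.le_ceil D'
      nlinarith [pow_le_pow_left₀ (by linarith) hceil 2]
    have h2 : D' * (p : ℝ) ^ (-(3 / 4 : ℝ)) ≤ 1 / 2 := by
      have hp1 : (1 : ℝ) ≤ p := by exact_mod_cast hp.one_lt.le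
      have hsqrt : 2 * D' ≤ (p : ℝ) ^ (1 / 2 : ℝ) := by
        have h4 : (2 * D') ^ 2 ≤ (p : ℝ) := by nlinarith
        calc 2 * D' = ((2 * D') ^ 2) ^ (1 / 2 : ℝ) := by
              rw [← Real.sqrt_eq_rpow, Real.sqrt_sq (by positivity)]
          _ ≤ (p : ℝ) ^ (1 / 2 : ℝ) := Real.rpow_le_rpow (by positivity) h4 (by norm_num)
      have h34 : (p : ℝ) ^ (1 / 2 : ℝ) ≤ (p : ℝ) ^ (3 / 4 : ℝ) :=
        Real.rpow_le_rpow_of_exponent_le hp1 (by norm_num)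
      have hpos : 0 < (p : ℝ) ^ (3 / 4 : ℝ) := by positivity
      rw [Real.rpow_neg hp0.le, ← div_eq_mul_inv, div_le_iff₀ hpos]
      linarith
    exact ⟨hγp, h1, h1.trans h2⟩
  have hu1 : ∀ p : ℕ, p.Prime → u p < 1 := by
    intro p hp
    rcases le_or_gt p Q' with h | h
    · exact hu_small p hp h
    · linarith [(hu_large p hp h).2.2]
  -- the weighted function, as a complex-valued function for the Euler product criterion
  set f : ℕ → ℂ := fun n => ((γ n * (n : ℝ) ^ δ : ℝ) : ℂ) with hf
  have hfnorm : ∀ n : ℕ, ‖f n‖ = |γ n| * (n : ℝ) ^ δ := by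
    intro n
    rw [hf]
    simp only [Complex.norm_real, Real.norm_eq_abs, abs_mul]
    rw [abs_of_nonneg (by positivity : (0 : ℝ) ≤ (n : ℝ) ^ δ)]
  have hf1 : f 1 = 1 := by
    simp [hf, hγ.map_one]
  have hfmul : ∀ {m n : ℕ}, m.Coprime n → f (m * n) = f m * f n := by
    intro m n hmn
    simp only [hf]
    rw [hγ.map_mul_of_coprime hmn]
    push_cast
    rw [Real.mul_rpow (Nat.cast_nonneg m) (Nat.cast_nonneg n)]
    push_cast
    ring
  -- prime-power bounds for `f`
  have hfpk : ∀ p k : ℕ, p.Prime → 1 ≤ k → ‖f (p ^ k)‖ ≤ (2 * k + 1) * u p ^ k := by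
    intro p k hp hk
    have hp0 : (0 : ℝ) ≤ p := Nat.cast_nonneg p
    rw [hfnorm]
    push_cast
    rw [← Real.rpow_natCast (p : ℝ) k, ← Real.rpow_mul hp0, mul_comm (k : ℝ) δ, Real.rpow_mul hp0,
      Real.rpow_natCast]
    calc |γ (p ^ k)| * ((p : ℝ) ^ δ) ^ k ≤ (2 * k + 1) * t p ^ k * ((p : ℝ) ^ δ) ^ k :=
          mul_le_mul_of_nonneg_right (hbound p k hp hk) (by positivity)
      _ = (2 * k + 1) * u p ^ k := by rw [hu]; ring
  have hfp0 : ∀ p : ℕ, p.Prime → ‖f (p ^ 0)‖ = 1 := by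
    intro p _; rw [pow_zero, hf1, norm_one]
  -- majorant at every prime: `m_p(k) = (2k+1) u_p^k` (`k ≥ 1`), `1` (`k = 0`)
  have hmaj : ∀ p : ℕ, p.Prime → ∀ k : ℕ, ‖f (p ^ k)‖ ≤ (if k = 0 then 1 else (2 * (k : ℝ) + 1) * u p ^ k) := by
    intro p hp k
    split_ifs with hk
    · rw [hk, hfp0 p hp]
    · exact hfpk p k hp (Nat.one_le_iff_ne_zero.mpr hk)
  have hmaj_summable : ∀ p : ℕ, p.Prime →
      Summable fun k : ℕ => (if k = 0 then (1 : ℝ) else (2 * (k : ℝ) + 1) * u p ^ k) := by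
    intro p hp
    have h := summable_two_mul_add_one_mul_pow (hu0 p hp) (hu1 p hp)
    refine (h.add (summable_of_ne_finset_zero (s := {0})
      (f := fun k : ℕ => if k = 0 then (1 : ℝ) - 1 else 0) ?_)).congr fun k => ?_
    · intro k hk; simp only [mem_singleton] at hk; simp [hk]
    · split_ifs with hk
      · subst hk; simp
      · simp
  have hloc_summable : ∀ {p : ℕ}, p.Prime → Summable fun k : ℕ => ‖f (p ^ k)‖ := by
    intro p hp
    exact Summable.of_nonneg_of_le (fun k => norm_nonneg _) (hmaj p hp) (hmaj_summable p hp)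
  -- the local factor is at least `1`
  have hloc_ge : ∀ p : ℕ, p.Prime → 1 ≤ ∑' k : ℕ, ‖f (p ^ k)‖ := by
    intro p hp
    calc (1 : ℝ) = ‖f (p ^ 0)‖ := (hfp0 p hp).symm
      _ = ∑ k ∈ ({0} : Finset ℕ), ‖f (p ^ k)‖ := by rw [sum_singleton]
      _ ≤ ∑' k : ℕ, ‖f (p ^ k)‖ := (hloc_summable hp).sum_le_tsum _ fun k _ => norm_nonneg _
  -- large primes: local factor `≤ 1 + 14 D'² p^{-3/2}`
  have hloc_large : ∀ p : ℕ, p.Prime → Q' < p →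
      ∑' k : ℕ, ‖f (p ^ k)‖ ≤ 1 + 14 * D' ^ 2 * (p : ℝ) ^ (-(3 / 2 : ℝ)) := by
    intro p hp hpQ
    have hp0 : (0 : ℝ) < p := by exact_mod_cast hp.pos
    obtain ⟨hγp, huD, hu2⟩ := hu_large p hp hpQ
    have hup := hu0 p hp
    have hs := hloc_summable hp
    rw [← hs.sum_add_tsum_nat_add 2]
    have hhead : ∑ k ∈ range 2, ‖f (p ^ k)‖ = 1 := by
      rw [sum_range_succ, sum_range_one, hfp0 p hp, pow_one]
      simp [hf, hγp]
    rw [hhead]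
    refine add_le_add le_rfl ?_
    -- tail: `∑_j ‖f(p^{j+2})‖ ≤ u² ∑_j (2j+5) u^j ≤ 14 u² ≤ 14 D'² p^{-3/2}`
    have htail_le : ∀ j : ℕ, ‖f (p ^ (j + 2))‖ ≤ u p ^ 2 * ((2 * (j : ℝ) + 5) * u p ^ j) := by
      intro j
      refine (hfpk p (j + 2) hp (by omega)).trans (le_of_eq ?_)
      push_cast; ring
    have hgs : Summable fun j : ℕ => (2 * (j : ℝ) + 5) * u p ^ j := by
      have h1 := summable_two_mul_add_one_mul_pow hup (hu1 p hp)
      have h2 : Summable fun k : ℕ => u p ^ k := summable_geometric_of_lt_one hup (hu1 p hp)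
      exact (h1.add (h2.mul_left 4)).congr fun k => by ring
    have hs2 : Summable fun j : ℕ => ‖f (p ^ (j + 2))‖ := (summable_nat_add_iff 2).mpr hs
    calc ∑' j : ℕ, ‖f (p ^ (j + 2))‖ ≤ ∑' j : ℕ, u p ^ 2 * ((2 * (j : ℝ) + 5) * u p ^ j) :=
          Summable.tsum_le_tsum htail_le hs2 (hgs.mul_left _)
      _ = u p ^ 2 * ∑' j : ℕ, (2 * (j : ℝ) + 5) * u p ^ j := tsum_mul_left
      _ ≤ u p ^ 2 * 14 :=
          mul_le_mul_of_nonneg_left (tsum_two_mul_add_five_mul_pow_le hup hu2) (by positivity)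
      _ ≤ (D' * (p : ℝ) ^ (-(3 / 4 : ℝ))) ^ 2 * 14 :=
          mul_le_mul_of_nonneg_right (pow_le_pow_left₀ hup huD 2) (by norm_num)
      _ = 14 * D' ^ 2 * (p : ℝ) ^ (-(3 / 2 : ℝ)) := by
          rw [mul_pow, ← Real.rpow_mul_natCast hp0.le]
          norm_num
          ring
  -- the excesses `T_p = (local factor) - 1` are summable over the primes
  set T : Nat.Primes → ℝ := fun p => (∑' k : ℕ, ‖f ((p : ℕ) ^ k)‖) - 1 with hT
  have hT0 : ∀ p : Nat.Primes, 0 ≤ T p := fun p => by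
    simp only [hT]; linarith [hloc_ge p p.prop]
  have hTle : ∀ p : Nat.Primes, ∑' k : ℕ, ‖f ((p : ℕ) ^ k)‖ ≤ 1 + T p := fun p => by
    simp only [hT]; linarith
  have hT_summable : Summable T := by
    -- split into the finitely many `p ≤ Q'` and the tail dominated by `14 D'² p^{-3/2}`
    set T₁ : Nat.Primes → ℝ := fun p => if (p : ℕ) ≤ Q' then T p else 0 with hT₁
    set T₂ : Nat.Primes → ℝ := fun p => if (p : ℕ) ≤ Q' then 0 else T p with hT₂
    have hsplit : T = T₁ + T₂ := by
      ext p; simp only [hT₁, hT₂, Pi.add_apply]; split_ifs <;> simp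
    rw [hsplit]
    refine Summable.add ?_ ?_
    · -- finite support
      refine summable_of_hasFiniteSupport ?_
      change (Function.support T₁).Finite
      refine ((Set.finite_Iic Q').preimage Nat.Primes.coe_nat_injective.injOn).subset ?_
      intro p hp
      simp only [hT₁] at hp
      simp only [Set.mem_preimage, Set.mem_Iic]
      by_contra h
      exact hp (if_neg h)
    · have hmaj2 : ∀ p : Nat.Primes, T₂ p ≤ 14 * D' ^ 2 * ((p : ℕ) : ℝ) ^ (-(3 / 2 : ℝ)) := by
        intro p
        simp only [hT₂]
        split_ifs with h
        · positivity
        · simp only [hT]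
          linarith [hloc_large p p.prop (not_le.mp h)]
      have hT₂0 : ∀ p : Nat.Primes, 0 ≤ T₂ p := fun p => by
        simp only [hT₂]; split_ifs; exacts [le_rfl, hT0 p]
      refine Summable.of_nonneg_of_le hT₂0 hmaj2 ?_
      exact (Nat.Primes.summable_rpow.mpr (by norm_num)).mul_left _
  -- conclude
  have hprod : ∀ s : Finset ℕ, ∏ p ∈ s with p.Prime, ∑' k : ℕ, ‖f (p ^ k)‖ ≤ Real.exp (∑' p, T p) :=
    prod_tsum_norm_prime_pow_le_exp hT0 hT_summable hTle
  have hsum := summable_norm_of_summable_norm_prime_pow hf1 hfmul hloc_summable hprod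
  refine ⟨δ, hδ0, hsum.congr fun n => hfnorm n⟩

end Summit.Parity.BatemanHorn.Theorems
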